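import Literature.MathematicalPhysics.QuantumFieldTheory.Balaban1983to89.B9CubeDirichletLetterAtOne
import Literature.MathematicalPhysics.QuantumFieldTheory.Balaban1983to89.B6MultiLevelTorusMirrorImageFold

/-!
# `Balaban1983to89.B9CubeDirichletLetterClosedBox` — [Balaban1985BackgroundPropagators] p. 394, p. 409 ∕ [Balaban1983RegularityDecay] (2.42) p. 584: THE DIRICHLET CUBE
# LETTER `G′_□(1)` ON THE CLOSED MIRROR BOX — its kernel at embedded sites is the signed image sum EVERYWHERE on the closed box (zero rows ∕ columns on the mirrors by the
# two cancellations), its rows against a function of the member's torus in SOURCE- and TARGET-image form, and the unit translations through the embedding (the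
# bookkeeping of the entries (3.42)₂,₃,₄ at `U = 1`; ROAD (I) «IMAGES», file D3e-β1)

FRAMING (verbatim cell line):
statement-level skeleton of published theorems with citation tags; proofs where landed; nothing here is a claim about the Yang–Mills mass gap

Sources: T. Bałaban, *Propagators for lattice gauge theories in a background field*, Commun. Math. Phys. **99** (1985) 389–434 [`Balaban1985BackgroundPropagators`],
p. 394 («Ω₀Δ′_a(U)Ω₀ … G′(U)»), Thm 3.1 (3.42) p. 397, p. 409 l. 1–5; T. Bałaban, *Regularity and decay of lattice Green's functions*, Commun. Math. Phys. **89**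
(1983) 571–597 [`Balaban1983RegularityDecay`], (2.42) p. 584, p. 572 («periodic conditions»); T. Bałaban, *Propagators and renormalization transformations for lattice
gauge theories. II*, Commun. Math. Phys. **96** (1984) 223–250 [`Balaban1984PropagatorsII`], (2.13) p. 225, (2.67) p. 234.  Unit `pub-ymgap-dag-n06-c` (g31).

## WHAT THIS FILE CERTIFIES (kernel-checked; `η = 1`, `L = ℓ + 1`)

For a global family `D`, a cover cube `q`, `F = cubeFam D q`, the mirror datum of D3c-α (`closedC` the closed box, `embCpt` the embedding of ANY site of the doubled torus,
`GrefC` the torus Green's function of the reflected cube family, `SIC x y = Σ_ε (−1)^{#ε}G′[F′](x, σ_ε y)` the signed image sum) and `K = GpDirOne D q` (D3c-β):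
* §1 `tshift_unit_val_of_closed`, ★ `emb_tshift_unit_of_closed` (the embedding intertwines the unit translations at EVERY site of the closed box — no wrap: `h ≥ 1`,
  `h + n + 1 < 2n`), `tshift_unit_mem_closedC`, `tshift_comp_neg_self` ∕ `tshift_neg_comp_self`;
* §2 `SIC_eq_zero_of_fst` ∕ `SIC_eq_zero_of_snd` (the image sum vanishes with either argument on a mirror), `SIC_switch`, `not_mem_dirDomC_of_closed_not_open`,
  ★★ `GpDirOne_embCpt` (`K(emb x, emb y) = SIC x y` for ALL `x, y` of the closed box), `GpDirOne_mulVec_embCpt` (`(Kf)(emb x) = Σ_{y ∈ X} SIC x y·f(emb y)`, `x` closed),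
  `GpDirOne_mulVec_eq_zero` (rows off `Ω₀(□)`);
* §3 the exchanges `sum_SIC_mul_eq_sourceImages` (`Σ_y SIC x y ψ y = Σ_ε (−1)^{#ε}(G′(ψ∘σ_ε))(x)`) and `sum_SIC_mul_eq_targetImages` (`= Σ_ε (−1)^{#ε}(G′ψ)(σ_ε x)`)
  (the transposed difference `(∂_μᵀf)(u) = f(u − e_μ) − f(u)` is r05's `B9Cor35ComparisonsGpCAtLetters.dT_transpose_mulVec`, in the import closure).

## HONEST SCOPE

Bookkeeping only (no estimate); the entries themselves are file D3e-β2.  Nothing continuum ∕ OS ∕ Clay; N06 is not discharged by this file; the YM mass gap is not proved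
by any of this.
-/

namespace Literature.MathematicalPhysics.QuantumFieldTheory.Balaban1983to89.B9CubeDirichletLetterClosedBox

noncomputable section

open Finset
open scoped Matrix
open Literature.MathematicalPhysics.QuantumFieldTheory.Balaban1983to89.B4Reflection242 (boxDom mem_boxDom blk)
open Literature.MathematicalPhysics.QuantumFieldTheory.Balaban1983to89.B6MultiLevelBoxOperator (N0 bigSide one_le_bigSide)
open Literature.MathematicalPhysics.QuantumFieldTheory.Balaban1983to89.B6MultiLevelTorusOperator (twrap tshift shiftMat unitVec mlOpT gmlT perLapT one_le_of_mem one_le_N0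
  tshift_val tshift_tshift tshift_zero shiftMat_neg shiftMat_mulVec twrap_twrap_add N0_eq_bigSide_mul)
open Literature.MathematicalPhysics.QuantumFieldTheory.Balaban1983to89.B6MultiLevelTorusOperatorL0 (TDomains)
open Literature.MathematicalPhysics.QuantumFieldTheory.Balaban1983to89.B6Prop22DerivMultiLevelTorus (dT dT_mulVec)
open Literature.MathematicalPhysics.QuantumFieldTheory.Balaban1983to89.B6Cover236MultiLevelBlocks (cubes)
open Literature.MathematicalPhysics.QuantumFieldTheory.Balaban1983to89.B9CubeSequence408 (cubeFam cube_level_le one_le_cube_level)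
open Literature.MathematicalPhysics.QuantumFieldTheory.Balaban1983to89.B9Thm31CubeLocalFlat (wCube wCube_pos)
open Literature.MathematicalPhysics.QuantumFieldTheory.Balaban1983to89.B4Eq242TorusMirrors
open Literature.MathematicalPhysics.QuantumFieldTheory.Balaban1983to89.B6MultiLevelTorusMirrorL0
open Literature.MathematicalPhysics.QuantumFieldTheory.Balaban1983to89.B6MultiLevelTorusMirrorDirichlet (one_le_N0_Pref)
open Literature.MathematicalPhysics.QuantumFieldTheory.Balaban1983to89.B6MultiLevelTorusMirrorCompression
open Literature.MathematicalPhysics.QuantumFieldTheory.Balaban1983to89.B6MultiLevelTorusMirrorImageFold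
open Literature.MathematicalPhysics.QuantumFieldTheory.Balaban1983to89.B9CubeSequence408Mirrors
open Literature.MathematicalPhysics.QuantumFieldTheory.Balaban1983to89.B9CubeDirichletLetterAtOne

variable {d : ℕ}

section

variable {ℓ Mh k R : ℕ} {P : Fin (d + 1) → ℕ}

/-! ## §0  Names for the cube's mirror objects -/

/-- the side vector of the doubled torus of □. [cite: Balaban1983RegularityDecay, (2.42) p.584, dictionary] -/
abbrev NrefC {D : B6MultiLevelTorusOperator.TDomains d ℓ Mh k P R} (q : ↥(cubes D.toDomains)) : Fin (d + 1) → ℕ :=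
  N0 ℓ Mh (kTop q) (Pref ℓ k (kTop q) P (mirC q) (mC q))

/-- the CLOSED mirror box of □ (open box plus the mirror hyperplanes). [cite: Balaban1983RegularityDecay, (2.42) p.584, dictionary] -/
abbrev closedC (D : B6MultiLevelTorusOperator.TDomains d ℓ Mh k P R) (q : ↥(cubes D.toDomains)) : Finset ↥(boxDom (NrefC q)) :=
  mirBoxClosed (NrefC q) (mirC q) (nMir ℓ Mh (kTop q) (mC q)) (fun _ => hMir ℓ Mh (kTop q))

/-- the mirror data of □ satisfy the standing binder. [cite: Balaban1983RegularityDecay, (2.42) p.584, bookkeeping] -/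
theorem hmirC {D : B6MultiLevelTorusOperator.TDomains d ℓ Mh k P R} (q : ↥(cubes D.toDomains)) (hL : Odd (ℓ + 1)) (hM : Odd Mh) (hMh : 1 ≤ Mh) :
    ∀ μ, mirC q μ = true → (NrefC q μ : ℤ) = 2 * nMir ℓ Mh (kTop q) (mC q) μ ∧ 0 ≤ hMir ℓ Mh (kTop q) ∧
      hMir ℓ Mh (kTop q) < nMir ℓ Mh (kTop q) (mC q) μ ∧ 2 ≤ nMir ℓ Mh (kTop q) (mC q) μ :=
  hmir_of_top (k := k) (k' := kTop q) (P := P) hL hM hMh (two_le_mC q)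

/-- the embedding of ANY site of the doubled torus into the member's torus (`y ↦ (y + g) mod N₀`). [cite: Balaban1984PropagatorsII, (2.1) p.224; Balaban1983RegularityDecay, (2.42) p.584, dictionary] -/
abbrev embCpt (D : B6MultiLevelTorusOperator.TDomains d ℓ Mh k P R) (q : ↥(cubes D.toDomains)) (hMh : 1 ≤ Mh) (hP : ∀ μ, 1 ≤ P μ)
    (y : ↥(boxDom (NrefC q))) : ↥(boxDom (N0 ℓ Mh k P)) :=
  ⟨B6MultiLevelTorusMirrorL0.emb (ℓ := ℓ) (Mh := Mh) (k := k) (P := P) (gC q) y.1, emb_mem hMh hP (gC q) y.1⟩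

/-- the torus Green's function of the reflected cube family (weights `wCube`). [cite: Balaban1984PropagatorsII, p.225 («G′ = Δ′_a^{−1}»); Balaban1983RegularityDecay, (2.42) p.584] -/
abbrev GrefC (D : B6MultiLevelTorusOperator.TDomains d ℓ Mh k P R) (q : ↥(cubes D.toDomains))
    (hL : Odd (ℓ + 1)) (hM : Odd Mh) (hMh : 1 ≤ Mh) (hP : ∀ μ, 1 ≤ P μ) : Matrix ↥(boxDom (NrefC q)) ↥(boxDom (NrefC q)) ℝ :=
  gmlT (NrefC q) ℓ (kTop q) (reflC D q hL hM hMh hP).lev (wCube ℓ)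

/-- THE SIGNED IMAGE SUM `SI(x, y) = Σ_ε (−1)^{#ε} G′[F′](x, σ_ε y)`. [cite: Balaban1983RegularityDecay, (2.42) p.584] -/
abbrev SIC (D : B6MultiLevelTorusOperator.TDomains d ℓ Mh k P R) (q : ↥(cubes D.toDomains))
    (hL : Odd (ℓ + 1)) (hM : Odd Mh) (hMh : 1 ≤ Mh) (hP : ∀ μ, 1 ≤ P μ) (x y : ↥(boxDom (NrefC q))) : ℝ :=
  ∑ ε ∈ mirIdx (mirC q), tsign ℝ (mirC q) ε * GrefC D q hL hM hMh hP x (trefl (hmirC q hL hM hMh) ε y)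

variable {D : B6MultiLevelTorusOperator.TDomains d ℓ Mh k P R} {q : ↥(cubes D.toDomains)}
  {hL : Odd (ℓ + 1)} {hM : Odd Mh} {hMh : 1 ≤ Mh} {hP : ∀ μ, 1 ≤ P μ}

/-! ## §1  Unit translations on the closed box and through the embedding -/

/-- `S_{k′} ≥ 4` (`L ≥ 2`, `k′ ≥ 1`), hence `h = (S_{k′} − 1)/2 ≥ 1` and `h + 1 < n`. [cite: Balaban1984PropagatorsII, (2.1) p.224, bookkeeping] -/
theorem mirror_room (hℓ : 1 ≤ ℓ) (hL : Odd (ℓ + 1)) (hM : Odd Mh) (hMh : 1 ≤ Mh) (q : ↥(cubes D.toDomains)) (μ : Fin (d + 1)) :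
    1 ≤ hMir ℓ Mh (kTop q) ∧ hMir ℓ Mh (kTop q) + 2 ≤ nMir ℓ Mh (kTop q) (mC q) μ := by
  have hs : 4 ≤ sTop ℓ Mh (kTop q) := by
    unfold sTop bigSide
    have h1 := one_le_kTop q
    have hpow : 4 ≤ (ℓ + 1) ^ (kTop q + 1) := by
      calc 4 = 2 ^ 2 := by norm_num
        _ ≤ (ℓ + 1) ^ 2 := Nat.pow_le_pow_left (by omega) 2
        _ ≤ (ℓ + 1) ^ (kTop q + 1) := Nat.pow_le_pow_right (by omega) (by omega)
    have : 4 ≤ Mh * (ℓ + 1) ^ (kTop q + 1) := le_trans hpow (Nat.le_mul_of_pos_left _ hMh)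
    exact_mod_cast this
  have hh := two_mul_hMir_add_one (ℓ := ℓ) (k' := kTop q) hL hM
  have hm : (4 : ℤ) ≤ (mC q μ : ℤ) := by have := two_le_mC q μ; unfold mC; push_cast; omega
  unfold nMir
  constructor
  · omega
  · nlinarith

/-- the coordinates of a unit translate of a CLOSED-box site are the plain shifted ones in the mirrored directions (no wrap).
[cite: Balaban1983RegularityDecay, p.572 («periodic conditions»), (2.42) p.584, bookkeeping] -/
theorem tshift_unit_val_of_closed (hℓ : 1 ≤ ℓ) (hL : Odd (ℓ + 1)) (hM : Odd Mh) (hMh : 1 ≤ Mh) {x : ↥(boxDom (NrefC q))} (hx : x ∈ closedC D q)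
    {v : Fin (d + 1) → ℤ} {μ : Fin (d + 1)} (hv : v = unitVec μ ∨ v = -unitVec μ) :
    ∀ ν, mirC q ν = true → (tshift (NrefC q) v x).1 ν = x.1 ν + v ν ∧ 0 ≤ x.1 ν + v ν ∧ x.1 ν + v ν < (NrefC q ν : ℤ) := by
  intro ν hν
  have hvν : v ν = 1 ∨ v ν = -1 ∨ v ν = 0 := by
    rcases hv with h | h <;> rw [h] <;> [rw [(unitVec_apply_cases μ ν).1]; rw [(unitVec_apply_cases μ ν).2]] <;> split_ifs <;> simp
  simp only [closedC, mirBoxClosed, Finset.mem_filter, Finset.mem_univ, true_and] at hx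
  obtain ⟨h1, h2⟩ := hx ν hν
  obtain ⟨hh1, hh2⟩ := mirror_room (D := D) hℓ hL hM hMh q ν
  have hN := N0_Pref_of_mir (ℓ := ℓ) (Mh := Mh) (k := k) (k' := kTop q) (P := P) (m := mC q) hν
  have hrange : 0 ≤ x.1 ν + v ν ∧ x.1 ν + v ν < (NrefC q ν : ℤ) := by
    show 0 ≤ x.1 ν + v ν ∧ x.1 ν + v ν < (N0 ℓ Mh (kTop q) (Pref ℓ k (kTop q) P (mirC q) (mC q)) ν : ℤ)
    rw [hN]; rcases hvν with h | h | h <;> rw [h] <;> constructor <;> omega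
  refine ⟨?_, hrange.1, hrange.2⟩
  rw [tshift_val]
  show (x.1 ν + v ν) % (N0 ℓ Mh (kTop q) (Pref ℓ k (kTop q) P (mirC q) (mC q)) ν : ℤ) = x.1 ν + v ν
  exact Int.emod_eq_of_lt hrange.1 hrange.2

/-- ★ **THE EMBEDDING INTERTWINES THE UNIT TRANSLATIONS ON THE CLOSED BOX**: `emb(x ± e_μ on the doubled torus) = emb(x) ± e_μ on the member's torus` for every `x ∈ X̄`.
[cite: Balaban1983RegularityDecay, p.572 («periodic conditions»), (2.42) p.584; Balaban1984PropagatorsII, (2.13) p.225, bookkeeping] -/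
theorem emb_tshift_unit_of_closed (hℓ : 1 ≤ ℓ) (hL : Odd (ℓ + 1)) (hM : Odd Mh) {x : ↥(boxDom (NrefC q))} (hx : x ∈ closedC D q)
    {v : Fin (d + 1) → ℤ} {μ : Fin (d + 1)} (hv : v = unitVec μ ∨ v = -unitVec μ) :
    embCpt D q hMh hP (tshift (NrefC q) v x) = tshift (N0 ℓ Mh k P) v (embCpt D q hMh hP x) := by
  have hcoord := tshift_unit_val_of_closed (D := D) hℓ hL hM hMh hx hv
  apply Subtype.ext
  rw [tshift_val (N0 ℓ Mh k P)]
  show B6MultiLevelTorusMirrorL0.emb (ℓ := ℓ) (Mh := Mh) (k := k) (P := P) (gC q) (tshift (NrefC q) v x).1 =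
    twrap (N0 ℓ Mh k P) (B6MultiLevelTorusMirrorL0.emb (ℓ := ℓ) (Mh := Mh) (k := k) (P := P) (gC q) x.1 + v)
  unfold B6MultiLevelTorusMirrorL0.emb
  rw [twrap_twrap_add]
  funext ν
  by_cases hν : mirC q ν = true
  · have h1 := (hcoord ν hν).1
    unfold twrap
    simp only [Pi.add_apply]
    rw [h1]; congr 1; ring
  · rw [tshift_val]
    unfold twrap
    simp only [Pi.add_apply]
    rw [show (NrefC q ν : ℤ) = (N0 ℓ Mh k P ν : ℤ) by
      show ((N0 ℓ Mh (kTop q) (Pref ℓ k (kTop q) P (mirC q) (mC q)) ν : ℕ) : ℤ) = _; rw [N0_Pref_of_not_mir (kTop_le q) hν],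
      Int.emod_add_emod]
    congr 1; ring

/-- an open-box site translated by `± e_μ` stays in the closed box. [cite: Balaban1983RegularityDecay, (2.42) p.584, bookkeeping] -/
theorem tshift_unit_mem_closedC (hL : Odd (ℓ + 1)) (hM : Odd Mh) (hMh : 1 ≤ Mh) {x : ↥(boxDom (NrefC q))} (hx : x ∈ boxC D q) {v : Fin (d + 1) → ℤ} {μ : Fin (d + 1)}
    (hv : v = unitVec μ ∨ v = -unitVec μ) :
    tshift (NrefC q) v x ∈ closedC D q :=
  (tshift_unit_mem_closed (hmirC q hL hM hMh) hx hv).1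

/-- translating by `−v` then by `v` is the identity. [cite: Balaban1983RegularityDecay, p.572, bookkeeping] -/
theorem tshift_comp_neg_self (N : Fin (d + 1) → ℕ) (v : Fin (d + 1) → ℤ) (x : ↥(boxDom N)) : tshift N v (tshift N (-v) x) = x := by
  rw [tshift_tshift, neg_add_cancel, tshift_zero]

/-- translating by `v` then by `−v` is the identity. [cite: Balaban1983RegularityDecay, p.572, bookkeeping] -/
theorem tshift_neg_comp_self (N : Fin (d + 1) → ℕ) (v : Fin (d + 1) → ℤ) (x : ↥(boxDom N)) : tshift N (-v) (tshift N v x) = x := by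
  rw [tshift_tshift, add_neg_cancel, tshift_zero]

/-! ## §2  The kernel on the closed box -/

/-- the image sum VANISHES when its first argument lies on a mirror (`G′[F′]` is jointly invariant). [cite: Balaban1983RegularityDecay, (2.42) p.584] -/
theorem SIC_eq_zero_of_fst (hℓ : 1 ≤ ℓ) {x : ↥(boxDom (NrefC q))} (hxc : x ∈ closedC D q) (hxo : x ∉ boxC D q) (y : ↥(boxDom (NrefC q))) :
    SIC D q hL hM hMh hP x y = 0 := by
  obtain ⟨μ, hμ, hfix⟩ := exists_single_fixed_of_mem_closed_not_mem_open (hmir := hmirC q hL hM hMh) hxc hxo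
  exact sum_images_eq_zero_of_fst_fixed (one_le_N0_Pref (k := k) (k' := kTop q) (P := P) hMh hP (two_le_mC q)) _ hμ
    (fun u w => gmlT_reflected_trefl (hL := hL) (hM := hM) (hMh := hMh) (hP := hP) (hk := kTop_le q) (hlev := lev_cubeFam_le_kTop q)
      (hm := two_le_mC q) (hg := sTop_dvd_gC q) (wCube ℓ) (wCube_pos hℓ) (B4Eq242TorusMirrors.single μ) u w) hfix y

/-- the image sum VANISHES when its second argument lies on a mirror (free). [cite: Balaban1983RegularityDecay, (2.42) p.584] -/
theorem SIC_eq_zero_of_snd {y : ↥(boxDom (NrefC q))} (hyc : y ∈ closedC D q) (hyo : y ∉ boxC D q) (x : ↥(boxDom (NrefC q))) :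
    SIC D q hL hM hMh hP x y = 0 := by
  obtain ⟨μ, hμ, hfix⟩ := exists_single_fixed_of_mem_closed_not_mem_open (hmir := hmirC q hL hM hMh) hyc hyo
  exact sum_images_eq_zero_of_snd_fixed _ hμ hfix x

/-- the image sum with the images on the TARGET: `SI(x, y) = Σ_ε (−1)^{#ε} G′(σ_ε x, y)`. [cite: Balaban1983RegularityDecay, (2.42) p.584, bookkeeping] -/
theorem SIC_switch (hℓ : 1 ≤ ℓ) (x y : ↥(boxDom (NrefC q))) :
    SIC D q hL hM hMh hP x y = ∑ ε ∈ mirIdx (mirC q), tsign ℝ (mirC q) ε * GrefC D q hL hM hMh hP (trefl (hmirC q hL hM hMh) ε x) y := by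
  refine Finset.sum_congr rfl fun ε _ => ?_
  rw [images_switch (GrefC D q hL hM hMh hP) (fun ε u w => gmlT_reflected_trefl (hL := hL) (hM := hM) (hMh := hMh) (hP := hP) (hk := kTop_le q)
    (hlev := lev_cubeFam_le_kTop q) (hm := two_le_mC q) (hg := sTop_dvd_gC q) (wCube ℓ) (wCube_pos hℓ) ε u w)]

/-- a site of the doubled torus off the open box does NOT embed into `Ω₀(□)` if it lies in the closed box (injectivity on `X̄`).
[cite: Balaban1984PropagatorsII, (2.1) p.224, bookkeeping] -/
theorem not_mem_dirDomC_of_closed_not_open {x : ↥(boxDom (NrefC q))} (hxc : x ∈ closedC D q) (hxo : x ∉ boxC D q) :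
    embCpt D q hMh hP x ∉ dirDomC D q hMh hP := by
  intro hmem
  obtain ⟨y, hy, he⟩ := (mem_dirDomC_iff hMh hP).1 hmem
  have : y = x := emb_injOn_closed hMh hP (kTop_le q) (fitC hMh q) (mirBoxOpen_subset_closed hy) hxc he
  subst this
  exact hxo hy

/-- ★★ **`G′_□(1)` AT TWO EMBEDDED SITES OF THE CLOSED BOX IS THE SIGNED IMAGE SUM** — on the open box by D3c-β `GpDirOne_apply_of_mem`, on the mirrors both sides vanish.
[cite: Balaban1985BackgroundPropagators, p.394 («Ω₀Δ′_aΩ₀ … G′»); Balaban1983RegularityDecay, (2.42) p.584] -/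
theorem GpDirOne_embCpt (hℓ : 1 ≤ ℓ) {x y : ↥(boxDom (NrefC q))} (hx : x ∈ closedC D q) (hy : y ∈ closedC D q) :
    GpDirOne D q hL hM hMh hP (embCpt D q hMh hP x) (embCpt D q hMh hP y) = SIC D q hL hM hMh hP x y := by
  by_cases hxo : x ∈ boxC D q
  · by_cases hyo : y ∈ boxC D q
    · exact GpDirOne_apply_of_mem (hL := hL) (hM := hM) (hMh := hMh) (hP := hP) hℓ ⟨x, hxo⟩ ⟨y, hyo⟩
    · rw [GpDirOne_apply_of_not_mem_right _ (not_mem_dirDomC_of_closed_not_open hy hyo), SIC_eq_zero_of_snd hy hyo]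
  · rw [GpDirOne_apply_of_not_mem_left (not_mem_dirDomC_of_closed_not_open hx hxo), SIC_eq_zero_of_fst hℓ hx hxo]

/-- rows of `G′_□(1)` off `Ω₀(□)` vanish. [cite: Balaban1985BackgroundPropagators, p.394, bookkeeping] -/
theorem GpDirOne_mulVec_eq_zero {z : ↥(boxDom (N0 ℓ Mh k P))} (hz : z ∉ dirDomC D q hMh hP) (f : ↥(boxDom (N0 ℓ Mh k P)) → ℝ) :
    (GpDirOne D q hL hM hMh hP *ᵥ f) z = 0 := by
  rw [Matrix.mulVec, dotProduct]
  exact Finset.sum_eq_zero fun w _ => by rw [GpDirOne_apply_of_not_mem_left hz, zero_mul]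

/-- ★ THE ROW OF `G′_□(1)` AT AN EMBEDDED CLOSED-BOX SITE against any function of the member's torus: `(Kf)(emb x) = Σ_{y ∈ X} SI(x, y)·f(emb y)`.
[cite: Balaban1985BackgroundPropagators, p.394; Balaban1983RegularityDecay, (2.42) p.584] -/
theorem GpDirOne_mulVec_embCpt (hℓ : 1 ≤ ℓ) {x : ↥(boxDom (NrefC q))} (hx : x ∈ closedC D q) (f : ↥(boxDom (N0 ℓ Mh k P)) → ℝ) :
    (GpDirOne D q hL hM hMh hP *ᵥ f) (embCpt D q hMh hP x) = ∑ y ∈ boxC D q, SIC D q hL hM hMh hP x y * f (embCpt D q hMh hP y) := by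
  classical
  rw [Matrix.mulVec, dotProduct]
  -- drop the columns off `Ω₀(□)`, pass to the subtype, reindex by the box
  rw [← Finset.sum_subset (Finset.subset_univ (dirDomC D q hMh hP))
    (fun w _ hw => by rw [GpDirOne_apply_of_not_mem_right _ hw, zero_mul])]
  rw [← Finset.sum_coe_sort (dirDomC D q hMh hP), ← Equiv.sum_comp (embEquivC D q hMh hP), ← Finset.sum_coe_sort (boxC D q)]
  refine Finset.sum_congr rfl fun v _ => ?_
  rw [embEquivC_apply]
  show GpDirOne D q hL hM hMh hP (embCpt D q hMh hP x) (embCpt D q hMh hP v.1) * f (embCpt D q hMh hP v.1) = _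
  rw [GpDirOne_embCpt hℓ hx (mirBoxOpen_subset_closed v.2)]

/-! ## §3  The exchanges -/

/-- `σ_ε` is an involution. [cite: Balaban1983RegularityDecay, (2.42) p.584, bookkeeping] -/
theorem trefl_trefl_self (ε : Fin (d + 1) → Bool) (w : ↥(boxDom (NrefC q))) :
    trefl (hmirC q hL hM hMh) ε (trefl (hmirC q hL hM hMh) ε w) = w := by
  have : trefl (hmirC q hL hM hMh) ε * trefl (hmirC q hL hM hMh) ε = 1 := by
    rw [trefl_mul]
    have : (fun μ => xor (ε μ) (ε μ)) = fun _ => false := funext fun μ => Bool.xor_self _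
    rw [this, trefl_bot]
  have h := congrArg (fun σ : Equiv.Perm ↥(boxDom (NrefC q)) => σ w) this
  simpa using h

/-- ★ EXCHANGE, SOURCE IMAGES: `Σ_y SI(x, y)ψ(y) = Σ_ε (−1)^{#ε} (G′(ψ ∘ σ_ε))(x)`. [cite: Balaban1983RegularityDecay, (2.42) p.584, bookkeeping] -/
theorem sum_SIC_mul_eq_sourceImages (x : ↥(boxDom (NrefC q))) (ψ : ↥(boxDom (NrefC q)) → ℝ) :
    ∑ y, SIC D q hL hM hMh hP x y * ψ y =
      ∑ ε ∈ mirIdx (mirC q), tsign ℝ (mirC q) ε * (GrefC D q hL hM hMh hP *ᵥ (fun w => ψ (trefl (hmirC q hL hM hMh) ε w))) x := by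
  have h1 : ∀ ε, (GrefC D q hL hM hMh hP *ᵥ (fun w => ψ (trefl (hmirC q hL hM hMh) ε w))) x =
      ∑ y, GrefC D q hL hM hMh hP x (trefl (hmirC q hL hM hMh) ε y) * ψ y := by
    intro ε
    rw [Matrix.mulVec, dotProduct]
    rw [← Equiv.sum_comp (trefl (hmirC q hL hM hMh) ε) (fun w => GrefC D q hL hM hMh hP x w * ψ (trefl (hmirC q hL hM hMh) ε w))]
    refine Finset.sum_congr rfl fun y _ => ?_
    rw [trefl_trefl_self (hL := hL) (hM := hM) (hMh := hMh)]
  simp_rw [h1, Finset.mul_sum, Finset.sum_mul]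
  rw [Finset.sum_comm]
  refine Finset.sum_congr rfl fun y _ => Finset.sum_congr rfl fun ε _ => ?_
  ring

/-- ★ EXCHANGE, TARGET IMAGES: `Σ_y SI(x, y)ψ(y) = Σ_ε (−1)^{#ε} (G′ψ)(σ_ε x)`. [cite: Balaban1983RegularityDecay, (2.42) p.584, bookkeeping] -/
theorem sum_SIC_mul_eq_targetImages (hℓ : 1 ≤ ℓ) (x : ↥(boxDom (NrefC q))) (ψ : ↥(boxDom (NrefC q)) → ℝ) :
    ∑ y, SIC D q hL hM hMh hP x y * ψ y =
      ∑ ε ∈ mirIdx (mirC q), tsign ℝ (mirC q) ε * (GrefC D q hL hM hMh hP *ᵥ ψ) (trefl (hmirC q hL hM hMh) ε x) := by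
  simp_rw [SIC_switch (hP := hP) hℓ, Finset.sum_mul]
  rw [Finset.sum_comm]
  refine Finset.sum_congr rfl fun ε _ => ?_
  rw [Matrix.mulVec, dotProduct, Finset.mul_sum]
  refine Finset.sum_congr rfl fun y _ => ?_
  ring

end

end

end Literature.MathematicalPhysics.QuantumFieldTheory.Balaban1983to89.B9CubeDirichletLetterClosedBox
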